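import Mathlib
import Literature.Analysis.FluidPDE.BeltramiFlows
import Literature.Analysis.FluidPDE.ClassicalSolution
import Summits.NavierStokesRegularity.NavierStokesRegularity.Theorems.QuarterLogPincerLimitSilenceDefs
import HarnessLib

/-!
# Line `silencing_cost`, stub Sc′ `ThickBoxSilencingCost`: the gradient bound and the parabolic inequality are
# load-bearing (kernel facts) — refuter lane ns-afl-r1

Supports crux stmt-NavierStokesRegularity-24077 (`QuarterLogPincer.TypeIQuantSubcubicExp`) via ns-idea-7's line
`Cruxes/TypeIQuantSubcubicExp/Lines/silencing_cost.lean` (v1.2, sha16 7454702080d03f79); the stub is in the tree BY NAME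
as `LimitSilence.ThickBoxSilencingCost` (`…Theorems.QuarterLogPincerLimitSilenceDefs`, pub-ns-dss typer g38).  NO Theses
decl is asserted; nothing about the crux or about Sc′ AS STATED is proved or refuted (HONEST FRAME: 24077, W7 and
Navier–Stokes regularity are OPEN).  Each theorem says that ONE hypothesis of the stub cannot be dropped («any proof must
use it»), with an explicit smooth witness built from the tree's ABC flows (`Literature/Analysis/FluidPDE/BeltramiFlows.lean`,
Majda–Bertozzi §2.3): the circularly polarised shear wave `a = abc 0 1 0 = (0, sin x₁, cos x₁)` has `|a| ≡ 1`,
`curl a = a`, `Δa = −a`.  The mutated statements are the parametrised defs `…At`; the one-line implications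
`thickBoxSilencingCost_of_noGrad` / `…_of_noIneq` into the NAMED stub certify that each mutation is the stub with exactly
one conjunct removed (everything else verbatim).

* `thickBoxSilencingCost_false_without_gradBound` — Sc′ with the conjunct `‖∇ω‖ ≤ Bσ⁻³` deleted is FALSE: the exact
  caloric Beltrami mode `ω(s,x) = σ⁻²e^{−s}a(x)` on `[0,σ²] × ℝ³` (`∂ₛω − Δω = 0`, `|ω| ≤ σ⁻²`) at `B = δ = Γ₂ = 1`
  burns the centre enstrophy `(4π/3)/σ` down to `(4π/3)K³e^{−2σ²}/σ < c/σ` at the burn-out scale `σ² = 5K³/c + 1`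
  (frequency `σ → ∞` in box units).  The gradient bound is exactly what caps the frequency (the card: «the `∇²u`
  bound CAPS THE FREQUENCY, which is what stops the high-frequency burn-out») — now a kernel-checked fact.
* `thickBoxSilencingCost_false_without_inequality` — Sc′ with the parabolic inequality deleted is FALSE (linear ramp
  `ω(s,x) = (1 − s)e₀`, `σ = 1`).
* shared witnesses for the companion file `SilencingCostLoadBearing.lean` (Sc, Sb): `norm_abc_shear`,
  `lipschitzWith_smul_abc_shear`, `lintegral_ball_of_norm_const`, `exists_burnout_scale`.
-/

-- the summit and its single sub-problem share the name (CONVENTIONS §1), as in every Theorems file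
set_option linter.dupNamespace false

namespace Summit.NavierStokesRegularity.NavierStokesRegularity.Theorems.TypeIQuantSubcubicExp.Negative.SilencingCost

noncomputable section

open MeasureTheory Set Function Filter Topology Metric Real
open scoped ENNReal NNReal Laplacian
open Literature.Analysis Literature.Analysis.FluidPDE
open Summit.NavierStokesRegularity.NavierStokesRegularity.Cruxes.TypeIQuantSubcubicExp.LimitSilence
  (ThickBoxSilencingCost)

/-! ## One-conjunct mutations of Sc′ (the stub itself BY NAME from the typer's Defs port) -/

/-- Sc′ at `(B, δ, Γ₂)` with the GRADIENT BOUND `‖∇ω‖ ≤ Bσ⁻³` deleted (everything else verbatim). -/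
def ThickBoxSilencingCostNoGradAt (B δ Γ₂ : ℝ) : Prop :=
  ∃ K c : ℝ, Γ₂ ≤ K ∧ 0 < c ∧ c ≤ δ ∧
    ∀ (ω : ℝ → (EuclideanSpace ℝ (Fin 3)) → (EuclideanSpace ℝ (Fin 3))) (y : (EuclideanSpace ℝ (Fin 3)))
      (σ t t₁ : ℝ), 0 < σ → t < t₁ → t₁ ≤ t + σ ^ 2 →
      IsSmoothSpaceTimeOn (Icc t t₁) ω →
      (∀ s ∈ Icc t t₁, ∀ x ∈ ball y (2 * K * σ),
        ‖ω s x‖ ≤ B * σ ^ (-(2 : ℝ)) ∧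
        ‖timeDerivWithin (Icc t t₁) ω s x - (Δ (ω s)) x‖ ≤
          B * σ ^ (-(2 : ℝ)) * ‖ω s x‖ + B * σ ^ (-(1 : ℝ)) * ‖fderiv ℝ (ω s) x‖) →
      ENNReal.ofReal (δ / σ) ≤ ∫⁻ x in ball y (Γ₂ * σ), ‖ω t x‖ₑ ^ 2 →
      ENNReal.ofReal (c / σ) ≤ ∫⁻ x in ball y (K * σ), ‖ω t₁ x‖ₑ ^ 2

/-- Sc′ at `(B, δ, Γ₂)` with the PARABOLIC INEQUALITY `|∂ₛω − Δω| ≤ Bσ⁻²|ω| + Bσ⁻¹|∇ω|` deleted (everything else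
verbatim). -/
def ThickBoxSilencingCostNoIneqAt (B δ Γ₂ : ℝ) : Prop :=
  ∃ K c : ℝ, Γ₂ ≤ K ∧ 0 < c ∧ c ≤ δ ∧
    ∀ (ω : ℝ → (EuclideanSpace ℝ (Fin 3)) → (EuclideanSpace ℝ (Fin 3))) (y : (EuclideanSpace ℝ (Fin 3)))
      (σ t t₁ : ℝ), 0 < σ → t < t₁ → t₁ ≤ t + σ ^ 2 →
      IsSmoothSpaceTimeOn (Icc t t₁) ω →
      (∀ s ∈ Icc t t₁, ∀ x ∈ ball y (2 * K * σ),
        ‖ω s x‖ ≤ B * σ ^ (-(2 : ℝ)) ∧ ‖fderiv ℝ (ω s) x‖ ≤ B * σ ^ (-(3 : ℝ))) →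
      ENNReal.ofReal (δ / σ) ≤ ∫⁻ x in ball y (Γ₂ * σ), ‖ω t x‖ₑ ^ 2 →
      ENNReal.ofReal (c / σ) ≤ ∫⁻ x in ball y (K * σ), ‖ω t₁ x‖ₑ ^ 2

/-- The variant without the gradient bound trivially implies Sc′ `LimitSilence.ThickBoxSilencingCost` BY NAME (it has
fewer hypotheses; the match certifies that everything else is verbatim). -/
theorem thickBoxSilencingCost_of_noGrad
    (h : ∀ B δ Γ₂ : ℝ, 1 ≤ B → 0 < δ → 1 ≤ Γ₂ → ThickBoxSilencingCostNoGradAt B δ Γ₂) :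
    ThickBoxSilencingCost := by
  intro B δ Γ₂ hB hδ hΓ
  obtain ⟨K, c, hK, hc, hcδ, H⟩ := h B δ Γ₂ hB hδ hΓ
  exact ⟨K, c, hK, hc, hcδ, fun ω y σ t t₁ hσ htt ht₁ hsm hbox =>
    H ω y σ t t₁ hσ htt ht₁ hsm fun s hs x hx => ⟨(hbox s hs x hx).1, (hbox s hs x hx).2.2⟩⟩

/-- The variant without the parabolic inequality trivially implies Sc′ BY NAME. -/
theorem thickBoxSilencingCost_of_noIneq
    (h : ∀ B δ Γ₂ : ℝ, 1 ≤ B → 0 < δ → 1 ≤ Γ₂ → ThickBoxSilencingCostNoIneqAt B δ Γ₂) :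
    ThickBoxSilencingCost := by
  intro B δ Γ₂ hB hδ hΓ
  obtain ⟨K, c, hK, hc, hcδ, H⟩ := h B δ Γ₂ hB hδ hΓ
  exact ⟨K, c, hK, hc, hcδ, fun ω y σ t t₁ hσ htt ht₁ hsm hbox =>
    H ω y σ t t₁ hσ htt ht₁ hsm fun s hs x hx => ⟨(hbox s hs x hx).1, (hbox s hs x hx).2.1⟩⟩

/-! ## The shear-wave witness `a = abc 0 1 0 = (0, sin x₁, cos x₁)` -/

/-- The circularly polarised shear wave `a = (0, sin x₁, cos x₁)` has unit length everywhere. -/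
theorem norm_abc_shear (x : EuclideanSpace ℝ (Fin 3)) : ‖ABC.abc 0 1 0 x‖ = 1 := by
  rw [EuclideanSpace.norm_eq, Fin.sum_univ_three, ABC.abc_apply_zero, ABC.abc_apply_one,
    ABC.abc_apply_two]
  simp [Real.sin_sq_add_cos_sq]

/-- `abc 0 b 0 = b · abc 0 1 0`. -/
theorem abc_shear_eq_smul (b : ℝ) (x : EuclideanSpace ℝ (Fin 3)) :
    ABC.abc 0 b 0 x = b • ABC.abc 0 1 0 x := by
  ext i
  fin_cases i <;> simp

/-- The shear wave is `2`-Lipschitz (crudely: each of its two live components is `1`-Lipschitz in `x₁`). -/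
theorem dist_abc_shear_le (p q : EuclideanSpace ℝ (Fin 3)) :
    dist (ABC.abc 0 1 0 p) (ABC.abc 0 1 0 q) ≤ 2 * dist p q := by
  have h0 : dist (p 0) (q 0) ≤ dist p q := PiLp.dist_apply_le p q 0
  have hs : dist (Real.sin (p 0)) (Real.sin (q 0)) ≤ dist (p 0) (q 0) := by
    rw [Real.dist_eq, Real.dist_eq]; exact Real.abs_sin_sub_sin_le _ _
  have hc : dist (Real.cos (p 0)) (Real.cos (q 0)) ≤ dist (p 0) (q 0) := by
    rw [Real.dist_eq, Real.dist_eq]; exact Real.abs_cos_sub_cos_le _ _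
  have hd : 0 ≤ dist p q := dist_nonneg
  have hds : 0 ≤ dist (Real.sin (p 0)) (Real.sin (q 0)) := dist_nonneg
  have hdc : 0 ≤ dist (Real.cos (p 0)) (Real.cos (q 0)) := dist_nonneg
  rw [EuclideanSpace.dist_eq, Fin.sum_univ_three]
  simp only [ABC.abc_apply_zero, ABC.abc_apply_one, ABC.abc_apply_two, zero_mul, one_mul, zero_add,
    add_zero, dist_self]
  calc Real.sqrt (0 ^ 2 + dist (Real.sin (p 0)) (Real.sin (q 0)) ^ 2
          + dist (Real.cos (p 0)) (Real.cos (q 0)) ^ 2)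
      ≤ Real.sqrt ((2 * dist p q) ^ 2) := Real.sqrt_le_sqrt (by nlinarith)
    _ = 2 * dist p q := Real.sqrt_sq (by positivity)

/-- `x ↦ κ · a(x)` is `2κ`-Lipschitz for `κ ≥ 0`. -/
theorem lipschitzWith_smul_abc_shear {κ : ℝ} (hκ : 0 ≤ κ) :
    LipschitzWith (Real.toNNReal (2 * κ)) (fun x => κ • ABC.abc 0 1 0 x) := by
  refine LipschitzWith.of_dist_le_mul fun p q => ?_
  rw [Real.coe_toNNReal _ (by positivity), dist_eq_norm, ← smul_sub, norm_smul, Real.norm_eq_abs,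
    abs_of_nonneg hκ, ← dist_eq_norm]
  have h := dist_abc_shear_le p q
  nlinarith [dist_nonneg (x := p) (y := q)]

/-- `∫_{B(y,r)} |f|² = m²·(4π/3)r³` for a field of constant length `m`. -/
theorem lintegral_ball_of_norm_const (f : (EuclideanSpace ℝ (Fin 3)) → (EuclideanSpace ℝ (Fin 3))) (m : ℝ)
    (hm : 0 ≤ m) (hf : ∀ x, ‖f x‖ = m) (y : EuclideanSpace ℝ (Fin 3)) (r : ℝ) (hr : 0 ≤ r) :
    ∫⁻ x in ball y r, ‖f x‖ₑ ^ 2 = ENNReal.ofReal (m ^ 2 * (r ^ 3 * (π * 4 / 3))) := by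
  have hpt : ∀ x, ‖f x‖ₑ ^ 2 = ENNReal.ofReal (m ^ 2) := by
    intro x
    rw [← ofReal_norm, hf, ENNReal.ofReal_pow hm]
  rw [lintegral_congr hpt, setLIntegral_const, EuclideanSpace.volume_ball_fin_three,
    ← ENNReal.ofReal_pow hr, ← ENNReal.ofReal_mul (by positivity), ← ENNReal.ofReal_mul (by positivity)]

/-- **The burn-out scale.**  For `K ≥ 1`, `c > 0` the scale `σ = √(5K³/c + 1) ≥ 1` has: amplitude `σ⁻²` on
`B(·,σ)` carries enstrophy `(4π/3)/σ ≥ 1/σ`, while amplitude `σ⁻²e^{−σ²}` on `B(·,Kσ)` carries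
`(4π/3)K³e^{−2σ²}/σ < c/σ` (because `c·e^{2σ²} ≥ c(1 + 2σ²) > 10K³ > (4π/3)K³`). -/
theorem exists_burnout_scale {K c : ℝ} (hK : 1 ≤ K) (hc : 0 < c) :
    ∃ σ : ℝ, 1 ≤ σ ∧
      1 / σ ≤ (σ ^ (-(2 : ℝ))) ^ 2 * ((1 * σ) ^ 3 * (π * 4 / 3)) ∧
      (σ ^ (-(2 : ℝ)) * Real.exp (-σ ^ 2)) ^ 2 * ((K * σ) ^ 3 * (π * 4 / 3)) < c / σ := by
  have hK0 : 0 < K := lt_of_lt_of_le one_pos hK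
  set S : ℝ := 5 * K ^ 3 / c + 1 with hS_def
  have hS1 : 1 ≤ S := by
    have : 0 ≤ 5 * K ^ 3 / c := by positivity
    linarith
  have hS0 : 0 < S := lt_of_lt_of_le one_pos hS1
  set σ : ℝ := Real.sqrt S with hσ_def
  have hσ1 : 1 ≤ σ := Real.one_le_sqrt.2 hS1
  have hσ0 : 0 < σ := lt_of_lt_of_le one_pos hσ1
  have hσsq : σ ^ 2 = S := Real.sq_sqrt hS0.le
  have hq : σ ^ (-(2 : ℝ)) = (σ ^ 2)⁻¹ := by
    rw [Real.rpow_neg hσ0.le, Real.rpow_two]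
  refine ⟨σ, hσ1, ?_, ?_⟩
  · rw [hq, one_mul]
    have hπ : 3 < π := Real.pi_gt_three
    rw [div_le_iff₀ hσ0]
    field_simp
    nlinarith [hσ0, pow_pos hσ0 2, pow_pos hσ0 3, pow_pos hσ0 4]
  · -- `c · e^{2σ²} ≥ c(1 + 2σ²) > 10K³`
    have hexp : 10 * K ^ 3 < c * Real.exp (2 * σ ^ 2) := by
      have h1 := Real.add_one_le_exp (2 * σ ^ 2)
      have h2 : 10 * K ^ 3 / c < 2 * σ ^ 2 + 1 := by
        have : 10 * K ^ 3 / c = 2 * (5 * K ^ 3 / c) := by ring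
        rw [this, hσsq, hS_def]; linarith
      exact (div_lt_iff₀' hc).1 (lt_of_lt_of_le h2 h1)
    have hE : 0 < Real.exp (2 * σ ^ 2) := Real.exp_pos _
    have hexp2 : Real.exp (-σ ^ 2) ^ 2 = (Real.exp (2 * σ ^ 2))⁻¹ := by
      rw [← Real.exp_nat_mul, ← Real.exp_neg]; congr 1; push_cast; ring
    set E := Real.exp (2 * σ ^ 2) with hE_def
    rw [hq, mul_pow, hexp2, inv_pow]
    have hπ : π < 4 := Real.pi_lt_four
    have hπK : π * K ^ 3 < 4 * K ^ 3 := mul_lt_mul_of_pos_right hπ (pow_pos hK0 3)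
    have h30 : π * 4 * K ^ 3 < 3 * (c * E) := by nlinarith [pow_pos hK0 3]
    rw [lt_div_iff₀ hσ0]
    field_simp
    nlinarith [mul_pos hE hc, pow_pos hσ0 4, mul_lt_mul_of_pos_right h30 (pow_pos hσ0 4),
      pow_pos hK0 3, pow_pos hσ0 2]

/-! ## Sc′: the gradient bound and the inequality are load-bearing -/

/-- **Sc′ needs the gradient bound.**  Without `‖∇ω‖ ≤ Bσ⁻³` the thick-box silencing cost fails: the exact
caloric Beltrami mode `ω(s,x) = σ⁻²e^{−s}·abc 0 1 0 (x)` on `[0,σ²] × ℝ³` (`∂ₛω = Δω`, `|ω| ≤ σ⁻²`) has centre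
enstrophy `(4π/3)/σ ≥ δ/σ` at `B = δ = Γ₂ = 1` and final enstrophy `(4π/3)K³e^{−2σ²}/σ < c/σ` at the burn-out
scale `σ² = 5K³/c + 1` (high-frequency burn-out: frequency `σ` in box units). [folklore] -/
theorem not_thickBoxSilencingCostNoGradAt_one : ¬ ThickBoxSilencingCostNoGradAt 1 1 1 := by
  intro h
  obtain ⟨K, c, hK, hc, -, H⟩ := h
  obtain ⟨σ, hσ1, hini, hfin⟩ := exists_burnout_scale hK hc
  have hσ0 : 0 < σ := lt_of_lt_of_le one_pos hσ1
  have hK0 : 0 < K := lt_of_lt_of_le one_pos hK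
  have hq0 : 0 < σ ^ (-(2 : ℝ)) := Real.rpow_pos_of_pos hσ0 _
  -- the witness
  set a : EuclideanSpace ℝ (Fin 3) → EuclideanSpace ℝ (Fin 3) := ABC.abc 0 1 0 with ha_def
  set ω : ℝ → EuclideanSpace ℝ (Fin 3) → EuclideanSpace ℝ (Fin 3) :=
    fun s x => (σ ^ (-(2 : ℝ)) * Real.exp (-s)) • a x with hω_def
  have hnorm : ∀ s x, ‖ω s x‖ = σ ^ (-(2 : ℝ)) * Real.exp (-s) := by
    intro s x
    rw [hω_def]
    dsimp only
    rw [norm_smul, ha_def, norm_abc_shear, mul_one, Real.norm_eq_abs,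
      abs_of_pos (mul_pos hq0 (Real.exp_pos _))]
  have key := H ω 0 σ 0 (σ ^ 2) hσ0 (by positivity) (by simp) ?_ ?_ ?_
  · -- the conclusion fails: final enstrophy on `B(0,Kσ)` is `(σ⁻²e^{-σ²})² · (4π/3)(Kσ)³ < c/σ`
    rw [lintegral_ball_of_norm_const (ω (σ ^ 2)) _ (mul_pos hq0 (Real.exp_pos _)).le (hnorm _) 0 (K * σ)
      (by positivity)] at key
    exact absurd key (not_le.2 ((ENNReal.ofReal_lt_ofReal_iff (by positivity)).2 hfin))
  · -- joint smoothness on `[0,σ²] × ℝ³`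
    change ContDiffOn ℝ _ (uncurry ω) _
    refine ContDiff.contDiffOn ?_
    have h1 : ContDiff ℝ ((⊤ : ℕ∞) : WithTop ℕ∞) fun p : ℝ × EuclideanSpace ℝ (Fin 3) =>
        σ ^ (-(2 : ℝ)) * Real.exp (-p.1) :=
      contDiff_const.mul (Real.contDiff_exp.comp contDiff_fst.neg)
    have h2 : ContDiff ℝ ((⊤ : ℕ∞) : WithTop ℕ∞) fun p : ℝ × EuclideanSpace ℝ (Fin 3) => a p.2 :=
      (ABC.contDiff_abc 0 1 0).comp contDiff_snd
    exact h1.smul h2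
  · -- the box bounds WITHOUT the gradient bound: `|ω| ≤ σ⁻²` and `∂ₛω − Δω = 0`
    intro s hs x _
    refine ⟨?_, ?_⟩
    · rw [hnorm, one_mul]
      have : Real.exp (-s) ≤ 1 := Real.exp_le_one_iff.2 (by linarith [hs.1])
      nlinarith
    · have hσ2pos : (0 : ℝ) < σ ^ 2 := by positivity
      -- time derivative within `[0,σ²]`
      have hderiv : timeDerivWithin (Icc 0 (σ ^ 2)) ω s x =
          (σ ^ (-(2 : ℝ)) * (Real.exp (-s) * -1)) • a x := by
        have hd : HasDerivAt (fun s' : ℝ => ω s' x)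
            ((σ ^ (-(2 : ℝ)) * (Real.exp (-s) * -1)) • a x) s := by
          have := ((hasDerivAt_neg s).exp.const_mul (σ ^ (-(2 : ℝ)))).smul_const (a x)
          simpa [hω_def] using this
        rw [timeDerivWithin]
        exact hd.hasDerivWithinAt.derivWithin (uniqueDiffOn_Icc hσ2pos s hs)
      -- Laplacian of the slice: `Δ(κ • a) = κ • Δa = −κ • a`
      have hlap : (Δ (ω s)) x = (σ ^ (-(2 : ℝ)) * Real.exp (-s)) • (-a x) := by
        have e1 : ω s = (σ ^ (-(2 : ℝ)) * Real.exp (-s)) • a := by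
          funext z; rfl
        rw [e1, InnerProductSpace.laplacian_smul _ ((ABC.contDiff_abc 0 1 0).contDiffAt (n := 2)), ha_def,
          ABC.laplacian_abc]
      rw [hderiv, hlap]
      have : (σ ^ (-(2 : ℝ)) * (Real.exp (-s) * -1)) • a x -
          (σ ^ (-(2 : ℝ)) * Real.exp (-s)) • -a x = 0 := by
        rw [smul_neg, sub_neg_eq_add, ← add_smul]
        have : σ ^ (-(2 : ℝ)) * (Real.exp (-s) * -1) + σ ^ (-(2 : ℝ)) * Real.exp (-s) = 0 := by ring
        rw [this, zero_smul]
      rw [this, norm_zero]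
      positivity
  · -- the initial centre enstrophy on `B(0,σ)` is `(σ⁻²)²·(4π/3)σ³ = (4π/3)/σ ≥ 1/σ`
    rw [lintegral_ball_of_norm_const (ω 0) (σ ^ (-(2 : ℝ))) hq0.le
      (fun x => by rw [hnorm, neg_zero, Real.exp_zero, mul_one]) 0 (1 * σ) (by positivity)]
    exact ENNReal.ofReal_le_ofReal hini

/-- **Sc′ needs the gradient bound** (the mutated stub, negated). -/
theorem thickBoxSilencingCost_false_without_gradBound :
    ¬ ∀ B δ Γ₂ : ℝ, 1 ≤ B → 0 < δ → 1 ≤ Γ₂ → ThickBoxSilencingCostNoGradAt B δ Γ₂ :=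
  fun h => not_thickBoxSilencingCostNoGradAt_one (h 1 1 1 le_rfl one_pos le_rfl)

/-- **Sc′ needs the parabolic inequality.**  Without `|∂ₛω − Δω| ≤ Bσ⁻²|ω| + Bσ⁻¹|∇ω|` the statement fails
already at `σ = 1`: the spatially constant linear ramp `ω(s,x) = (1 − s)e₀` on `[0,1]` (`|ω| ≤ 1`, `∇ω = 0`) has
centre enstrophy `4π/3 ≥ 1` and vanishes identically at the final time. [folklore] -/
theorem not_thickBoxSilencingCostNoIneqAt_one : ¬ ThickBoxSilencingCostNoIneqAt 1 1 1 := by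
  intro h
  obtain ⟨K, c, hK, hc, -, H⟩ := h
  have hK0 : 0 < K := lt_of_lt_of_le one_pos hK
  set e₀ : EuclideanSpace ℝ (Fin 3) := EuclideanSpace.single 0 1 with he_def
  have he : ‖e₀‖ = 1 := by rw [he_def]; simp
  set ω : ℝ → EuclideanSpace ℝ (Fin 3) → EuclideanSpace ℝ (Fin 3) := fun s _ => (1 - s) • e₀ with hω_def
  have hnorm : ∀ s x, s ≤ 1 → ‖ω s x‖ = 1 - s := by
    intro s x hs
    rw [hω_def]
    dsimp only
    rw [norm_smul, he, mul_one, Real.norm_eq_abs, abs_of_nonneg (by linarith)]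
  have key := H ω 0 1 0 1 one_pos one_pos (by norm_num) ?_ ?_ ?_
  · rw [lintegral_ball_of_norm_const (ω 1) 0 le_rfl (fun x => by rw [hnorm 1 x le_rfl, sub_self]) 0 (K * 1)
      (by positivity)] at key
    have : ENNReal.ofReal ((0 : ℝ) ^ 2 * ((K * 1) ^ 3 * (π * 4 / 3))) = 0 := by simp
    rw [this, div_one] at key
    exact absurd key (not_le.2 (ENNReal.ofReal_pos.2 hc))
  · change ContDiffOn ℝ _ (uncurry ω) _
    refine ContDiff.contDiffOn ?_
    have h1 : ContDiff ℝ ((⊤ : ℕ∞) : WithTop ℕ∞) fun p : ℝ × EuclideanSpace ℝ (Fin 3) => (1 : ℝ) - p.1 :=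
      contDiff_const.sub contDiff_fst
    exact h1.smul contDiff_const
  · intro s hs x _
    refine ⟨?_, ?_⟩
    · rw [hnorm s x hs.2, Real.one_rpow, mul_one]
      linarith [hs.1]
    · have : fderiv ℝ (ω s) x = 0 := by
        change fderiv ℝ (fun _ : EuclideanSpace ℝ (Fin 3) => ((1 : ℝ) - s) • e₀) x = 0
        simp
      rw [this, norm_zero]
      positivity
  · rw [lintegral_ball_of_norm_const (ω 0) 1 zero_le_one (fun x => by rw [hnorm 0 x zero_le_one, sub_zero]) 0
      (1 * 1) (by positivity)]
    refine ENNReal.ofReal_le_ofReal ?_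
    nlinarith [Real.pi_gt_three]

/-- **Sc′ needs the parabolic inequality** (the mutated stub, negated). -/
theorem thickBoxSilencingCost_false_without_inequality :
    ¬ ∀ B δ Γ₂ : ℝ, 1 ≤ B → 0 < δ → 1 ≤ Γ₂ → ThickBoxSilencingCostNoIneqAt B δ Γ₂ :=
  fun h => not_thickBoxSilencingCostNoIneqAt_one (h 1 1 1 le_rfl one_pos le_rfl)

end

end Summit.NavierStokesRegularity.NavierStokesRegularity.Theorems.TypeIQuantSubcubicExp.Negative.SilencingCost
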